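import Summits.FinalStateConjecture.FinalStateConjecture.Theses.TangentConeAtIPlus

/-!
# `FiniteKerrParticleCone` (stmt-FinalStateConjecture-17668, route TangentConeAtIPlus) — negative-side
# lemma: the `Cone` / `Island` world-tube of ONE island can swallow the whole late half-space

Refuter seat `refuter-skel-stmt-FinalStateConjecture-17668-vet-0` (skeleton vet of the registered line
`Cruxes/FiniteKerrParticleCone/Lines/birth.lean`), 2026-08-17. Nothing here closes the item; these are
kernel-checked NEGATIVE LEMMAS (pure `E4` geometry, no spacetime) exhibiting a junk degree of freedom
in the crux's own `Cone` predicate (route file `Theses/TangentConeAtIPlus.lean`, items 17668–17671,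
17673 all embed it) and, verbatim, in the skeleton's `Island` predicate.

In `Cone` the tube of island `i` is
`tube i w := (fun x ↦ x + dr i (t i x)) '' {x | d i x ≤ σ i (t i x) + w} ∩ {y | T < y 0}`,
generated by ALL rest times `t i x ∈ ℝ`, while the radius `σ i` and the drift `dr i` are constrained
only `atTop` (`(|σ i s| + ‖dr i s‖) / s → 0`, `σ i → ∞`; in `Island` only `σ i s / s → 0`). The PAST
half of the world-tube (rest times `s ≤ 0`) therefore has a free radius and a free drift, and the
drift's TIME component carries past rest slices to arbitrary LATE lab times.

* `leakRadius`, `leakDrift` — an explicit continuous pair: radius `1 + √s` (`s ≥ 0`) / `1 + s²`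
  (`s ≤ 0`); drift `0` (`s ≥ 0`) / `(s²(1 + cos s)/2 − s) • e₀` (`s ≤ 0`), purely temporal.
* `leak_cone_kinematic_clause` — with motion `(1, 0)` this pair satisfies the kinematic clause of
  `Cone` VERBATIM (orthochronous, continuous, `(|σ| + ‖dr‖)/s → 0`, `σ → ∞`) and that of `Island`.
* `tube_eq_lateHalfspace` — for `T ≥ 0` and every fattening `w ≥ 0` the route's tube, VERBATIM,
  satisfies `tube 0 w = {y | T < y 0}`: the rest slice `s = -(2πk + θ)` is carried to lab time
  `s²(1 + cos s)/2`, which sweeps `[0, (2πk)²]` as `θ` runs over `[0, π]`, with ball radius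
  `1 + s² ≥ (2πk)²` (intermediate value theorem + Archimedes).
* `leak_consequences` — hence (N = 1) the covering clause `{T < y 0} \ ⋃ i, tube i 0 ⊆ U` holds for
  EVERY `U : Opens E4` (even `⊥`), and the `Island` interior-flatness domain
  `{x 0 = τ ∧ |x̲| ≤ (1-δ)τ} \ ⋃ i, tube i (δτ)` is EMPTY for every `τ > T`.

Reading (see the vet report attached to the item): a prover of the crux may take `N = 1`, this
`(σ, dr)`, and `U` := thin collars `{|t − τₖ| < 1, σ + 1 ≤ d < σ + 4}` around the recurrent Kerr
windows of ONE settling sub-extremal hole; then `deviationExtend (backgroundOn U) Φ` vanishes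
identically near the `Cone` flatness region `{d ≥ δτ}` (seminorm `0` eventually), `deviationCk` sees
only the collars, `IsLateChart` has no covering condition, and the crux's witness says nothing about
the rest of the development (other holes, extremal or hairy remnants, late cascades). The intended
confinement content is not captured; the repair is to generate tubes from late rest times only
(`T ≤ t i x`) and, for `Island`, to make the drift foliation-preserving
(`(poincareInv (mo i).1 0 (dr i s)) 0 = 0`).

## References

* M. Dafermos, J. Luk, arXiv:1710.01722, §1.2.1 (the final-state picture the clauses formalise).
* B. O'Neill, *Semi-Riemannian geometry*, Academic Press 1983, Ch. 9, p. 236 (Poincaré motions;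
  `poincareInv 1 0 = id`).
-/

-- the problem namespace `FinalStateConjecture.FinalStateConjecture` (single-conjunct summit) trips dupNamespace
set_option linter.dupNamespace false

noncomputable section

namespace Summit.FinalStateConjecture.FinalStateConjecture.Theorems.FiniteKerrParticleCone.Negative

open scoped Topology
open Filter Set TopologicalSpace Literature.Geometry.Lorentzian

/-- Tube radius: `1 + √s` for `s ≥ 0` (continuous, sublinear, `→ ∞`), `1 + s²` for `s ≤ 0`
(free past). [folklore] -/
def leakRadius (s : ℝ) : ℝ := 1 + Real.sqrt s + (min s 0) ^ 2

/-- Lab time hit by the rest slice `s`: `s² (1 + cos s)/2` for `s ≤ 0` (it sweeps `[0, (2πk)²]` on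
`[-(π + 2πk), -2πk]` for every `k`), `0` for `s ≥ 0`. [folklore] -/
def leakSweep (s : ℝ) : ℝ := (min s 0) ^ 2 * ((1 + Real.cos s) / 2)

/-- The unit time vector `e₀ = (1, 0, 0, 0)` (`= E4.basisVector 0`). [folklore] -/
def e0 : E4 := EuclideanSpace.single 0 1

/-- Drift: purely temporal, `(leakSweep s - s) • e₀` for `s ≤ 0`, `0` for `s ≥ 0`. [folklore] -/
def leakDrift (s : ℝ) : E4 := (leakSweep s - min s 0) • e0

/-- `leakRadius` is continuous. [folklore] -/
theorem continuous_leakRadius : Continuous leakRadius :=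
  (continuous_const.add Real.continuous_sqrt).add ((continuous_id.min continuous_const).pow 2)

/-- `leakSweep` is continuous. [folklore] -/
theorem continuous_leakSweep : Continuous leakSweep :=
  ((continuous_id.min continuous_const).pow 2).mul
    ((continuous_const.add Real.continuous_cos).div_const 2)

/-- `leakDrift` is continuous. [folklore] -/
theorem continuous_leakDrift : Continuous leakDrift :=
  (continuous_leakSweep.sub (continuous_id.min continuous_const)).smul continuous_const

/-- Late radius: `1 + √s`. [folklore] -/
theorem leakRadius_of_nonneg {s : ℝ} (hs : 0 ≤ s) : leakRadius s = 1 + Real.sqrt s := by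
  simp [leakRadius, min_eq_right hs]

/-- Past radius: `1 + s²`. [folklore] -/
theorem leakRadius_of_nonpos {s : ℝ} (hs : s ≤ 0) : leakRadius s = 1 + s ^ 2 := by
  simp [leakRadius, min_eq_left hs, Real.sqrt_eq_zero_of_nonpos hs]

/-- The radius is nonnegative. [folklore] -/
theorem leakRadius_nonneg (s : ℝ) : 0 ≤ leakRadius s := by
  unfold leakRadius; positivity

/-- No sweep at late rest times. [folklore] -/
theorem leakSweep_of_nonneg {s : ℝ} (hs : 0 ≤ s) : leakSweep s = 0 := by
  simp [leakSweep, min_eq_right hs]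

/-- The past sweep `s²(1 + cos s)/2`. [folklore] -/
theorem leakSweep_of_nonpos {s : ℝ} (hs : s ≤ 0) :
    leakSweep s = s ^ 2 * ((1 + Real.cos s) / 2) := by
  simp [leakSweep, min_eq_left hs]

/-- No drift at late rest times (so the `atTop` clauses see `dr = 0`). [folklore] -/
theorem leakDrift_of_nonneg {s : ℝ} (hs : 0 ≤ s) : leakDrift s = 0 := by
  simp [leakDrift, leakSweep_of_nonneg hs, min_eq_right hs]

/-- The past drift `(leakSweep s − s) • e₀`. [folklore] -/
theorem leakDrift_of_nonpos {s : ℝ} (hs : s ≤ 0) : leakDrift s = (leakSweep s - s) • e0 := by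
  simp [leakDrift, min_eq_left hs]

/-- Time coordinate of `y + r • e₀`. [folklore] -/
theorem apply_zero_add_smul_e0 (y : E4) (r : ℝ) : (y + r • e0) 0 = y 0 + r := by
  simp [e0]

/-- `e₀` has no spatial part. [folklore] -/
theorem spatial_e0 : E4.spatial e0 = 0 := by
  ext i
  simp [e0, E4.spatial_apply, Fin.succ_ne_zero]

/-- Temporal translation keeps the spatial radius. [folklore] -/
theorem spatialNorm_add_smul_e0 (y : E4) (r : ℝ) :
    E4.spatialNorm (y + r • e0) = E4.spatialNorm y := by
  simp [E4.spatialNorm, map_add, map_smul, spatial_e0]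

/-- `√s → ∞` (as `s ^ (1/2)`, `tendsto_rpow_atTop`). [folklore] -/
theorem tendsto_sqrt_atTop : Tendsto Real.sqrt atTop atTop :=
  (tendsto_rpow_atTop (by norm_num : (0 : ℝ) < 1 / 2)).congr'
    (Eventually.of_forall fun s => (Real.sqrt_eq_rpow s).symm)

/-- The kinematic clause of `Cone` (hence of `Island`) for `(leakRadius, leakDrift)`: continuity,
`(|σ| + ‖dr‖)/s → 0` (for `s ≥ 1` the quotient is `(1 + √s)/s ≤ 2 s^{-1/2}`), `σ → ∞`, `σ/s → 0`.
[folklore] -/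
theorem leak_kinematics :
    Continuous leakRadius ∧ Continuous leakDrift ∧
      Tendsto (fun s : ℝ ↦ (|leakRadius s| + ‖leakDrift s‖) / s) atTop (𝓝 0) ∧
        Tendsto leakRadius atTop atTop ∧
          Tendsto (fun s : ℝ ↦ leakRadius s / s) atTop (𝓝 0) := by
  have hmain : Tendsto (fun s : ℝ ↦ (|leakRadius s| + ‖leakDrift s‖) / s) atTop (𝓝 0) := by
    have h1 : Tendsto (fun s : ℝ => 2 * s ^ (-(1 / 2 : ℝ))) atTop (𝓝 0) := by
      simpa using (tendsto_rpow_neg_atTop (by norm_num : (0 : ℝ) < 1 / 2)).const_mul 2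
    refine tendsto_of_tendsto_of_tendsto_of_le_of_le' tendsto_const_nhds h1 ?_ ?_
    · filter_upwards [eventually_ge_atTop 1] with s hs
      exact div_nonneg (add_nonneg (abs_nonneg _) (norm_nonneg _)) (by linarith)
    · filter_upwards [eventually_ge_atTop 1] with s hs
      have hs0 : 0 ≤ s := by linarith
      have hsq : 1 ≤ Real.sqrt s := Real.one_le_sqrt.mpr hs
      have hspos : 0 < Real.sqrt s := by linarith
      rw [leakRadius_of_nonneg hs0, leakDrift_of_nonneg hs0, norm_zero, add_zero,
        abs_of_nonneg (by positivity), Real.rpow_neg hs0, ← Real.sqrt_eq_rpow,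
        div_le_iff₀ (by linarith : (0 : ℝ) < s)]
      have hss : (Real.sqrt s)⁻¹ * s = Real.sqrt s := by
        rw [inv_mul_eq_iff_eq_mul₀ hspos.ne']
        exact (Real.mul_self_sqrt hs0).symm
      calc 1 + Real.sqrt s ≤ Real.sqrt s + Real.sqrt s := by linarith
        _ = 2 * ((Real.sqrt s)⁻¹ * s) := by rw [hss]; ring
        _ = 2 * (Real.sqrt s)⁻¹ * s := by ring
  refine ⟨continuous_leakRadius, continuous_leakDrift, hmain, ?_, ?_⟩
  · refine tendsto_atTop_mono (fun s => ?_) tendsto_sqrt_atTop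
    unfold leakRadius
    nlinarith [sq_nonneg (min s 0)]
  · refine hmain.congr' ?_
    filter_upwards [eventually_ge_atTop 0] with s hs
    rw [leakDrift_of_nonneg hs, norm_zero, add_zero, abs_of_nonneg (leakRadius_nonneg s)]

/-- **The swallow.** For `T ≥ 0`, `w ≥ 0`: every point `y` of the late half-space `{T < y 0}` is a
drifted point of the (fattened) rest-frame tube `{|x̲| ≤ leakRadius (x 0) + w}`: with `k ≥ y 0 + |y̲| + 1`
the sweep `leakSweep` takes the value `y 0 ∈ [0, (2πk)²]` at some rest time `s ∈ [-(π + 2πk), -2πk]`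
(intermediate value theorem), where the radius is `1 + s² ≥ (2πk)² ≥ |y̲|`; the preimage is
`y + (s − y 0) • e₀`. [folklore] -/
theorem leak_swallows {T : ℝ} (hT : 0 ≤ T) {w : ℝ} (hw : 0 ≤ w) {y : E4} (hy : T < y 0) :
    y ∈ (fun x : E4 ↦ x + leakDrift (x 0)) '' {x : E4 | E4.spatialNorm x ≤ leakRadius (x 0) + w} := by
  obtain ⟨k, hk⟩ := exists_nat_ge (y 0 + E4.spatialNorm y + 1)
  have hy0 : 0 < y 0 := lt_of_le_of_lt hT hy
  have hsn : 0 ≤ E4.spatialNorm y := E4.spatialNorm_nonneg y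
  have hk1 : (1 : ℝ) ≤ k := by linarith
  have hk0 : (0 : ℝ) ≤ k := by linarith
  set c : ℝ := (k : ℝ) * (2 * Real.pi) with hc
  have hπ : (1 : ℝ) ≤ 2 * Real.pi := by linarith [Real.pi_gt_three]
  have hkc : (k : ℝ) ≤ c := le_mul_of_one_le_right hk0 hπ
  have hc1 : (1 : ℝ) ≤ c := hk1.trans hkc
  have hc0 : (0 : ℝ) ≤ c := by linarith
  have hcc : c ≤ c ^ 2 := by nlinarith
  -- IVT on `[a, b] = [-(π + c), -c]`
  set a : ℝ := -(Real.pi + c) with ha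
  set b : ℝ := -c with hb
  have hab : a ≤ b := by rw [ha, hb]; linarith [Real.pi_pos]
  have hb0 : b ≤ 0 := by rw [hb]; linarith
  have ha0 : a ≤ 0 := hab.trans hb0
  have hfa : leakSweep a = 0 := by
    rw [leakSweep_of_nonpos ha0]
    have : Real.cos a = -1 := by
      rw [ha, Real.cos_neg, hc, (Real.cos_periodic.nat_mul k) Real.pi]
      exact Real.cos_pi
    rw [this]; ring
  have hfb : leakSweep b = c ^ 2 := by
    rw [leakSweep_of_nonpos hb0]
    have : Real.cos b = 1 := by
      rw [hb, Real.cos_neg, hc, Real.cos_nat_mul_two_pi]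
    rw [this, hb]; ring
  have hmem : y 0 ∈ Icc (leakSweep a) (leakSweep b) := by
    rw [hfa, hfb]
    exact ⟨hy0.le, by linarith⟩
  obtain ⟨s, hs, hps⟩ := intermediate_value_Icc hab continuous_leakSweep.continuousOn hmem
  have hs0 : s ≤ 0 := hs.2.trans hb0
  have hcs : c ≤ -s := by rw [hb] at hs; linarith [hs.2]
  have hs2 : c ^ 2 ≤ s ^ 2 := by
    have h : 0 ≤ (-s - c) * (-s + c) := mul_nonneg (by linarith) (by linarith)
    nlinarith [h]
  refine ⟨y + (s - y 0) • e0, ?_, ?_⟩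
  · -- membership in the rest-frame tube: rest time `s`, spatial radius `|y̲| ≤ 1 + s² + w`
    show E4.spatialNorm (y + (s - y 0) • e0) ≤ leakRadius ((y + (s - y 0) • e0) 0) + w
    rw [spatialNorm_add_smul_e0, apply_zero_add_smul_e0, add_sub_cancel, leakRadius_of_nonpos hs0]
    linarith
  · -- the drift moves it to `y`
    show (y + (s - y 0) • e0) + leakDrift ((y + (s - y 0) • e0) 0) = y
    rw [apply_zero_add_smul_e0, add_sub_cancel, leakDrift_of_nonpos hs0, hps, add_assoc, ← add_smul]
    have : s - y 0 + (y 0 - s) = 0 := by ring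
    rw [this, zero_smul, add_zero]

/-- **The route's tube, verbatim, for `N = 1`, motion `(1, 0)`, `(σ, dr) = (leakRadius, leakDrift)`:
`tube 0 w = {T < y 0}` for every `w ≥ 0` (`T ≥ 0`).** The `let`s are copied from
`Theses.TangentConeAtIPlus.FiniteKerrParticleCone` (and the skeleton's `Island`). [folklore] -/
theorem tube_eq_lateHalfspace {T : ℝ} (hT : 0 ≤ T) {w : ℝ} (hw : 0 ≤ w) :
    (let mo : Fin 1 → lorentzGroup × E4 := fun _ => (1, 0)
     let σ : Fin 1 → ℝ → ℝ := fun _ => leakRadius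
     let dr : Fin 1 → ℝ → E4 := fun _ => leakDrift
     let t := fun i (x : E4) => poincareInv (mo i).1 (mo i).2 x 0
     let d := fun i (x : E4) => E4.spatialNorm (poincareInv (mo i).1 (mo i).2 x)
     let tube := fun i (w : ℝ) =>
       (fun x ↦ x + dr i (t i x)) '' {x : E4 | d i x ≤ σ i (t i x) + w} ∩ {y | T < y 0}
     tube 0 w = {y : E4 | T < y 0}) := by
  intro mo σ dr t d tube
  /- `poincareInv 1 0 = id` (as `Literature.Geometry.Lorentzian.poincareInv_one_zero`, re-proved to keep
  the import list to the route file alone) -/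
  have hP : ∀ x : E4, poincareInv 1 0 x = x := fun x => by rw [poincareInv, sub_zero]; rfl
  show (fun x : E4 ↦ x + leakDrift (poincareInv 1 0 x 0)) ''
      {x : E4 | E4.spatialNorm (poincareInv 1 0 x) ≤ leakRadius (poincareInv 1 0 x 0) + w} ∩
      {y : E4 | T < y 0} = {y : E4 | T < y 0}
  simp only [hP]
  ext y
  exact ⟨fun h => h.2, fun hy => ⟨leak_swallows hT hw hy, hy⟩⟩

/-- **Kinematic clause of `Cone`, verbatim, for this island** (orthochronous `1`, continuity,
`(|σ| + ‖dr‖)/s → 0`, `σ → ∞`); the `Island` clause (`σ s / s → 0`) as well. [folklore] -/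
theorem leak_cone_kinematic_clause :
    (let mo : Fin 1 → lorentzGroup × E4 := fun _ => (1, 0)
     let σ : Fin 1 → ℝ → ℝ := fun _ => leakRadius
     let dr : Fin 1 → ℝ → E4 := fun _ => leakDrift
     (∀ i, Summit.FinalStateConjecture.IsOrthochronous (mo i).1 ∧ Continuous (σ i) ∧
        Continuous (dr i) ∧ Tendsto (fun s : ℝ ↦ (|σ i s| + ‖dr i s‖) / s) atTop (𝓝 0) ∧
          Tendsto (σ i) atTop atTop) ∧
     (∀ i, Summit.FinalStateConjecture.IsOrthochronous (mo i).1 ∧ Continuous (σ i) ∧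
        Continuous (dr i) ∧ Tendsto (fun s : ℝ ↦ σ i s / s) atTop (𝓝 0) ∧
          Tendsto (σ i) atTop atTop)) := by
  intro mo σ dr
  have hO : Summit.FinalStateConjecture.IsOrthochronous (1 : lorentzGroup) := by
    show (0 : ℝ) < (((1 : lorentzGroup) : E4 ≃L[ℝ] E4) (E4.basisVector 0)) 0
    have : (((1 : lorentzGroup) : E4 ≃L[ℝ] E4) (E4.basisVector 0)) = E4.basisVector 0 := rfl
    rw [this]
    simp
  obtain ⟨hc1, hc2, h3, h4, h5⟩ := leak_kinematics
  exact ⟨fun _ => ⟨hO, hc1, hc2, h3, h4⟩, fun _ => ⟨hO, hc1, hc2, h5, h4⟩⟩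

/-- **Consequences for the route's clauses (N = 1).** With the tube equal to the late half-space:
(i) the covering clause `{T < y 0} \ ⋃ i, tube i 0 ⊆ U` holds for EVERY `U : Opens E4`, in
particular for `U = ⊥`; (ii) the `Island` interior-flatness domain at every `τ > T` is empty.
[folklore] -/
theorem leak_consequences {T : ℝ} (hT : 0 ≤ T) :
    (let mo : Fin 1 → lorentzGroup × E4 := fun _ => (1, 0)
     let σ : Fin 1 → ℝ → ℝ := fun _ => leakRadius
     let dr : Fin 1 → ℝ → E4 := fun _ => leakDrift
     let t := fun i (x : E4) => poincareInv (mo i).1 (mo i).2 x 0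
     let d := fun i (x : E4) => E4.spatialNorm (poincareInv (mo i).1 (mo i).2 x)
     let tube := fun i (w : ℝ) =>
       (fun x ↦ x + dr i (t i x)) '' {x : E4 | d i x ≤ σ i (t i x) + w} ∩ {y | T < y 0}
     (∀ U : Opens E4, {y : E4 | T < y 0} \ (⋃ i, tube i 0) ⊆ (U : Set E4)) ∧
     (∀ δ τ : ℝ, 0 ≤ δ → T < τ → 0 ≤ τ →
        {x : E4 | x 0 = τ ∧ E4.spatialNorm x ≤ (1 - δ) * τ} \ (⋃ i, tube i (δ * τ)) = ∅)) := by
  intro mo σ dr t d tube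
  have htube : ∀ w : ℝ, 0 ≤ w → tube 0 w = {y : E4 | T < y 0} := fun w hw =>
    tube_eq_lateHalfspace hT hw
  refine ⟨fun U => ?_, fun δ τ hδ hτ hτ0 => ?_⟩
  · intro y hy
    exact absurd (mem_iUnion.mpr ⟨0, (htube 0 le_rfl).symm ▸ hy.1⟩) hy.2
  · refine Set.eq_empty_of_forall_notMem fun x hx => hx.2 ?_
    have hx0 : x 0 = τ := hx.1.1
    exact mem_iUnion.mpr ⟨0, (htube (δ * τ) (mul_nonneg hδ hτ0)).symm ▸ (show T < x 0 by rw [hx0]; exact hτ)⟩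

end Summit.FinalStateConjecture.FinalStateConjecture.Theorems.FiniteKerrParticleCone.Negative

end
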